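import Summits.NavierStokesRegularity.NavierStokesRegularity.Theorems.OddMorawetzOddMorawetzLocalActMatrixSemantics
import Summits.NavierStokesRegularity.NavierStokesRegularity.Theorems.OddMorawetzOddMorawetzLocalDensVInjective
import Summits.NavierStokesRegularity.NavierStokesRegularity.Theorems.OddMorawetzOddMorawetzLocalToLIE
import HarnessLib

/-!
# Crux `OddMorawetzLocal` (stmt-NavierStokesRegularity-1376), refutation — `O(3)`-invariance of the density
is fixedness of its coefficient vector

Stub `actMatrix_fixed_of_invariant` of the refutation skeleton of `OddMorawetzLocal` (line `registered`,
lead c1).  Mathlib (unitary group, `WithLp`, `Finset` sums) on top of the landed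
`densV_actMatrix_jetAct` / `evalA_polyOfV` (`…ActMatrixSemantics`), `densV_injective` / `jetAct_mem_symmJets`
(`…DensVInjective`) and `exists_unitaryGroup_toLIE` (`…ToLIE`); no named facts; nothing is defined.

By the sibling's isotropic reduction a Morawetz certificate density `m` may be assumed `O(3)`-invariant,
`m (jetAct g z) = m z` for every linear isometry `g` of `ℝ³`, and by `structure_densV` it is `densV k τ` on the
symmetric jets `symmJets` for a coefficient vector `τ : V k` on the monomial basis `idx k`.  This file turns the
invariance into the finite statement `actMatrix k G *ᵥ τ = τ` for every orthogonal matrix `G`: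

* the orthogonal matrix `G` is the matrix of a linear isometry `R` of `EuclideanSpace ℝ (Fin 3)`
  (`exists_unitaryGroup_toLIE`), whose inverse has matrix `Gᵀ` (`G * Gᵀ = 1`);
* on a symmetric jet `z`, `densV k (actMatrix k G *ᵥ τ) z = densV k τ (jetAct R z) = m (jetAct R z) = m z
  = densV k τ z` (`densV_actMatrix_jetAct`, `jetAct_mem_symmJets`, invariance);
* `densV` is linear in `τ`, so the density of `actMatrix k G *ᵥ τ - τ` vanishes on `symmJets`, whence the
  difference is zero (`densV_injective`).
-/

noncomputable section

set_option linter.dupNamespace false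
set_option autoImplicit false

namespace Summit.NavierStokesRegularity.NavierStokesRegularity.Theorems.OddMorawetz

/-- `densV` is additive in the coefficient vector: the density of a difference is the difference of the
densities. -/
theorem densV_sub (k : ℕ) (τ τ' : V k) (z : Jet3) :
    densV k (τ - τ') z = densV k τ z - densV k τ' z := by
  show JPoly.evalA (polyOfV k (τ - τ')) (fun v => JVar.coord v z) =
    JPoly.evalA (polyOfV k τ) (fun v => JVar.coord v z) - JPoly.evalA (polyOfV k τ') (fun v => JVar.coord v z)
  rw [evalA_polyOfV, evalA_polyOfV, evalA_polyOfV, ← Finset.sum_sub_distrib]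
  exact Finset.sum_congr rfl fun i _ => by rw [Pi.sub_apply, sub_mul]

/-- The inverse of a linear isometry of `ℝ³` whose matrix `G` is orthogonal has matrix `Gᵀ`. -/
theorem symm_apply_of_mem_unitaryGroup {G : Matrix (Fin 3) (Fin 3) ℝ}
    (hG : G ∈ Matrix.unitaryGroup (Fin 3) ℝ)
    (R : EuclideanSpace ℝ (Fin 3) ≃ₗᵢ[ℝ] EuclideanSpace ℝ (Fin 3))
    (hR : ∀ x, R x = WithLp.toLp 2 (G.mulVec (WithLp.ofLp x))) (x : EuclideanSpace ℝ (Fin 3)) :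
    R.symm x = WithLp.toLp 2 (G.transpose.mulVec (WithLp.ofLp x)) := by
  have hGGt : G * G.transpose = 1 := by
    have h := Matrix.mem_unitaryGroup_iff.1 hG
    rwa [Matrix.star_eq_conjTranspose, Matrix.conjTranspose_eq_transpose_of_trivial] at h
  apply R.injective
  rw [R.apply_symm_apply, hR, WithLp.ofLp_toLp, Matrix.mulVec_mulVec, hGGt, Matrix.one_mulVec,
    WithLp.toLp_ofLp]

/-- **Stub `actMatrix_fixed_of_invariant`** (refutation of crux `OddMorawetzLocal`): if `m` agrees with the
density `densV k τ` on symmetric jets and is invariant under the jet action of every linear isometry of `ℝ³`,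
then the coefficient vector `τ` is fixed by the action matrix of every orthogonal matrix:
`actMatrix k G *ᵥ τ = τ` for all `G ∈ O(3)`. -/
theorem actMatrix_fixed_of_invariant (k : ℕ) {m : Jet3 → ℝ} (τ : V k)
    (hm : ∀ z : Jet3, z ∈ symmJets → m z = densV k τ z)
    (hinv : ∀ (g : EuclideanSpace ℝ (Fin 3) ≃ₗᵢ[ℝ] EuclideanSpace ℝ (Fin 3)) (z : Jet3), m (jetAct g z) = m z) :
    ∀ G ∈ Matrix.unitaryGroup (Fin 3) ℝ, (actMatrix k (G : Matrix (Fin 3) (Fin 3) ℝ)).mulVec τ = τ := by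
  intro G hG
  obtain ⟨Φ, hΦ⟩ := exists_unitaryGroup_toLIE
  -- the linear isometry with matrix `G`; its inverse has matrix `Gᵀ`
  have hR : ∀ x, Φ ⟨G, hG⟩ x = WithLp.toLp 2 (G.mulVec (WithLp.ofLp x)) := fun x => hΦ ⟨G, hG⟩ x
  have hRs : ∀ x, (Φ ⟨G, hG⟩).symm x = WithLp.toLp 2 (G.transpose.mulVec (WithLp.ofLp x)) :=
    symm_apply_of_mem_unitaryGroup hG (Φ ⟨G, hG⟩) hR
  -- the density of `actMatrix k G *ᵥ τ - τ` vanishes on symmetric jets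
  have h0 : (actMatrix k G).mulVec τ - τ = 0 := by
    refine densV_injective k _ fun z hz => ?_
    rw [densV_sub, densV_actMatrix_jetAct k G (Φ ⟨G, hG⟩) hR hRs τ z hz, ← hm _ (jetAct_mem_symmJets _ hz),
      hinv, hm z hz, sub_self]
  exact sub_eq_zero.1 h0

end Summit.NavierStokesRegularity.NavierStokesRegularity.Theorems.OddMorawetz

end
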